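import Summits.QuantumFields.YangMills.Theorems.FluctuationComparisonRegPrIntLS2BetaSourceBudgetCore
import Literature.MathematicalPhysics.QuantumFieldTheory.Balaban1983to89.T3ContinuumYM3Torus
import HarnessLib

/-!
# S2β · (SCT″-c)₁, S-KER LETTER 2 — «THE SOURCE-BUDGET CORE ON THE THREE-TORUS»: px13 g27's ✓`weighted_readMax_sq_le_sources` at `P := F.P K`, `m := K − J`, with the (ST)
# weights `Λ n := Cst·L^{K−J−1−n}` (`n < K − J`, else `0`) — the flatness letter DISCHARGED at `d = 3` (`μ_P = L⁻¹`, `Λs j := Cst·L^{K−J−1}∕L^{4j}`, `n`-free) and `4 ≤ L³`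

Cell `ym3-torus` (YM ladder rung R3 = continuum `SU(2)` Yang–Mills on the three-torus at fixed lattice data — a RUNG: NOT d = 4, NOT infinite volume, NOT a mass gap,
NOT Clay).  Width seat «width 16» `ym3-torus-px16` (gen 23), S2β pairing-letter lane holder; crux `stmt-QuantumFields-20520`, LINE g18-1 S2β.
`--kind proof --supports stmt-QuantumFields-20520 --as helper`, count-neutral, DEFINITION-FREE (0 `def`, 0 `instance`, 0 `notation`, 0 `sorry`, default heartbeats).

WHY.  The (SCT″-c)₁ supplier sums the NC-row constants `c₁ t` with the (ST) weights `L^t` (`t = K−J−1−n` for the internal level `n` of `F.P K`); the lattice-generic engine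
✓p832878 `weighted_readMax_sq_le_sources` (px13 g27) carries abstract weights `Λ`, `Λs` and a FLATNESS hypothesis; on `T³` (`d = 3`) the dilution factor is `μ_P = L²∕L³ = L⁻¹`
(✓`mLL_eq`) and the flatness `Λ n·(μ_P^{n−j}∕(L³)^j)²·(L³)^n ≤ Λs j` holds with EQUALITY for `j ≤ n` at `Λs j = Cst·L^{K−J−1}∕L^{4j}` — THIS FILE discharges it and the side
conditions, leaving the read-cell clause, the rows and the C–S weights `w`, `W` abstract (the assembler's choice).

WHAT IS PROVED (sorry-free; `F : T3Family`, `J ≤ K`).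
§1 ★`four_le_L_cube` (`4 ≤ L³` from `1 < L`); ★`mP_T3` (`μ_{F.P K} = (F.L)⁻¹`); ★★`flat_T3` — the flatness letter at `d = 3` for `Λ n := if n < K−J then Cst·L^{K−J−1−n} else 0`,
   `Λs j := Cst·L^{K−J−1}∕L^{4j}` (exponent comparison, both cases `j ≤ n` ∕ `n < j`).
§2 ★★★`weighted_readMax_sq_le_sources_T3` — ✓`weighted_readMax_sq_le_sources` so instantiated: for rows with sources on `F.P K` up to `m = K − J`, read cells `sel` under the
   (M-3) clause at thickness `θ`, ends of multiplicity `≤ η`, and any C–S weights `w > 0` with `Σ_{j∈Icc 1 n} w_j⁻¹ ≤ W`: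
   `Σ_{n ≤ K−J} Λ n·Σ_i ρ n (sel n i)² ≤ 2·(Cst·L^{K−J−1}·25²·((2θ+5)³η)·C_b·(1·Σ_z ρ 0 z²)) + 2·W·Σ_{j∈Icc 1 (K−J)} w j·(Cst·L^{K−J−1}∕L^{4j}·25²·((2θ+5)³η)·C_b·((L³)^j·Σ_c src j c²))`,
   `C_b = 2(L³−1)∕(L³−3)` — the data at the top (ST) weight over `L`, each source level `j` at `L^{K−J−1−j}` (its own (ST) weight) — K-UNIFORM constants.

HONEST SCOPE.  Arithmetic instantiation of a landed letter; nothing of Bałaban's analysis is asserted or proved ([Balaban1985Averaging] (19)–(20) p.21, Prop. 4 (128)–(135) pp.37–38;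
[Balaban1987RG1] (0.1)–(0.4), (0.11) pp.251–253); the rows (✓p831575 ∕ rows v2 under RULING (β-3)′), the source energies ((BKG), (RSP)), NC-ROW′, (ST″), LOC″, h3 are HYPOTHESES
elsewhere; GAP♯∘ (`stub_uniformFibreGapOrbit`, registry untouched, 0∕5), S2β, crux 20520, 19936, 19200 and `YM3TorusSU2` are NOT proved; no registered stub is closed; rung R3 =
SU(2) YM₃ on T³ — NOT d = 4, NOT infinite volume, NOT a mass gap, NOT Clay; the Yang–Mills mass gap is NOT proved.
-/

set_option autoImplicit false

noncomputable section

open Finset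

namespace Summit.QuantumFields.YangMills.Theorems.FluctuationComparisonRegPrIntLS2BetaCurlBudgetT3

open Literature.MathematicalPhysics.QuantumFieldTheory.Balaban1983to89
open Literature.MathematicalPhysics.QuantumFieldTheory.Balaban1983to89.T4Continuum
open Literature.MathematicalPhysics.QuantumFieldTheory.Balaban1983to89.T3ContinuumYM3Torus
open Literature.MathematicalPhysics.QuantumFieldTheory.Balaban1983to89.BlockAveraging (Idx)
open Literature.MathematicalPhysics.QuantumFieldTheory.Balaban1983to89.B10Eq47AxialChi (shiftN)
open Literature.MathematicalPhysics.QuantumFieldTheory.Balaban1983to89.B14.Eq22Determines (blockIter)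
open Literature.MathematicalPhysics.QuantumFieldTheory.Balaban1983to89.B10Eq27TorusAxialLog (rel)
open Summit.QuantumFields.YangMills.Theorems.FluctuationComparisonRegPrIntLS2BetaComposedDilutionKernel (mLL_eq)
open Summit.QuantumFields.YangMills.Theorems.FluctuationComparisonRegPrIntLS2BetaSourceBudgetCore (weighted_readMax_sq_le_sources)

variable (F : T3Family)

/-! ## §1 The `T³` constants -/

/-- ★ `4 ≤ L³` on the three-torus family (`L > 1`). [cite: Balaban1985UV3, (1)-(3) p.256] -/
theorem four_le_L_cube (K : ℕ) : 4 ≤ (F.P K).L ^ (F.P K).d := by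
  have hL : 2 ≤ F.L := F.hL.2
  show 4 ≤ F.L ^ 3
  calc 4 = 2 ^ 2 := by norm_num
    _ ≤ F.L ^ 2 := Nat.pow_le_pow_left hL 2
    _ ≤ F.L ^ 3 := Nat.pow_le_pow_right (by omega) (by norm_num)

/-- ★ The dilution factor on `T³`: `(d!)²L²∕|I| = L²∕L³ = L⁻¹`. [cite: Balaban1985Averaging, (19)-(20) p.21] -/
theorem mP_T3 (K : ℕ) :
    ((((Fintype.card (Equiv.Perm (Fin (F.P K).d))) ^ 2 * (F.P K).L ^ 2 : ℕ) : ℝ) / (Fintype.card (Idx (F.P K)) : ℝ)) = ((F.L : ℝ))⁻¹ := by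
  rw [mLL_eq]
  have hd : (F.P K).d = 3 := rfl
  have hLF : (F.P K).L = F.L := rfl
  rw [hd, hLF]
  have hL : (0 : ℝ) < (F.L : ℝ) := by exact_mod_cast (lt_trans zero_lt_one F.hL.2)
  field_simp

/-- ★★ **FLATNESS AT `d = 3`**: with `Λ n := if n < K−J then Cst·L^{K−J−1−n} else 0` and `Λs j := Cst·L^{K−J−1}∕L^{4j}` (`Cst ≥ 0`),
`Λ n·(μ_P^{n−j}∕(L³)^j)²·(L³)^n ≤ Λs j` for all `j, n ≤ K − J` (equality when `j ≤ n < K−J`). [cite: Balaban1985Averaging, Prop. 4 (128)-(135) pp.37-38] -/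
theorem flat_T3 {J K : ℕ} (Cst : ℝ) (hCst : 0 ≤ Cst) (j : ℕ) (n : ℕ) :
    (if n < K - J then Cst * (F.L : ℝ) ^ (K - J - 1 - n) else 0) *
        (((((Fintype.card (Equiv.Perm (Fin (F.P K).d))) ^ 2 * (F.P K).L ^ 2 : ℕ) : ℝ) / (Fintype.card (Idx (F.P K)) : ℝ)) ^ (n - j) /
            (((F.P K).L ^ (F.P K).d : ℕ) : ℝ) ^ j) ^ 2 *
          (((F.P K).L ^ (F.P K).d : ℕ) : ℝ) ^ n ≤
      Cst * (F.L : ℝ) ^ (K - J - 1) / (F.L : ℝ) ^ (4 * j) := by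
  have hL1 : (1 : ℝ) ≤ (F.L : ℝ) := by exact_mod_cast F.hL.2.le
  have hL0 : (0 : ℝ) < (F.L : ℝ) := lt_of_lt_of_le zero_lt_one hL1
  have hd : (F.P K).d = 3 := rfl
  have hLF : (F.P K).L = F.L := rfl
  rw [mP_T3]
  rw [hd, hLF]
  push_cast
  split_ifs with hn
  · -- `n < K − J`: compare exponents
    rw [inv_pow, ← pow_mul, ← pow_mul]
    have e1 : Cst * (F.L : ℝ) ^ (K - J - 1 - n) * (((F.L : ℝ) ^ (n - j))⁻¹ / (F.L : ℝ) ^ (3 * j)) ^ 2 * (F.L : ℝ) ^ (3 * n) =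
        Cst * ((F.L : ℝ) ^ (K - J - 1 - n + 3 * n) / (F.L : ℝ) ^ (2 * (n - j) + 6 * j)) := by
      field_simp
      ring
    rw [e1, mul_div_assoc]
    refine mul_le_mul_of_nonneg_left ?_ hCst
    rw [div_le_div_iff₀ (pow_pos hL0 _) (pow_pos hL0 _), ← pow_add, ← pow_add]
    exact pow_le_pow_right₀ hL1 (by omega)
  · -- `n ≥ K − J`: the weight vanishes
    rw [zero_mul, zero_mul]
    exact div_nonneg (mul_nonneg hCst (pow_nonneg hL0.le _)) (pow_nonneg hL0.le _)

/-! ## §2 The engine on `T³` -/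

/-- ★★★ **THE SOURCE-BUDGET CORE ON `T³`** — ✓`weighted_readMax_sq_le_sources` at `P := F.P K`, `m := K − J`, (ST) weights `Λ n := Cst·L^{K−J−1−n}` (`n < K−J`), flatness and
`4 ≤ L³` discharged; rows, read cells and C–S weights abstract. [cite: Balaban1985Averaging, (19)-(20) p.21, Prop. 4 (128)-(135) pp.37-38; Balaban1987RG1, (0.1)-(0.4), (0.11) pp.251-253] -/
theorem weighted_readMax_sq_le_sources_T3 {J K : ℕ} (hJK : J ≤ K) {μ ν : Fin (F.P K).d} (hμν : μ ≠ ν)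
    {ι : Type*} [Fintype ι] (ends : ι → Finset (Site (F.P K) (K - J))) (θ η : ℕ)
    (hends : ∀ e : Site (F.P K) (K - J), (univ.filter (fun i : ι => e ∈ ends i)).card ≤ η)
    (ρ src : (i : ℕ) → Site (F.P K) i → ℝ) (hρ : ∀ i x, 0 ≤ ρ i x) (hsrc : ∀ i x, 0 ≤ src i x)
    (hrow : ∀ i, i < K - J → ∀ y' : Site (F.P K) (i + 1),
        ρ (i + 1) y' ≤ (Fintype.card (Idx (F.P K)) : ℝ)⁻¹ *
            ∑ a ∈ (Finset.univ : Finset (Idx (F.P K))) ×ˢ (Finset.range (F.P K).L ×ˢ Finset.range (F.P K).L),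
              ρ i (shiftN (shiftN (Site.blockSite y' a.1.1) μ a.2.1) ν a.2.2) +
          src (i + 1) y')
    (Cst : ℝ) (hCst : 0 ≤ Cst)
    (w : ℕ → ℝ) (hw : ∀ j, 0 < w j) (W : ℝ) (hW : ∀ n, n ≤ K - J → ∑ j ∈ Finset.Icc 1 n, (w j)⁻¹ ≤ W)
    (sel : (n : ℕ) → ι → Site (F.P K) n)
    (hsel : ∀ n, n ≤ K - J → ∀ i, ∃ z : Site (F.P K) 0, blockIter (K - J) z ∈ ends i ∧ ∀ κ, (rel (blockIter n z) (sel n i) κ).natAbs ≤ θ) :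
    ∑ n ∈ Finset.range (K - J + 1), (if n < K - J then Cst * (F.L : ℝ) ^ (K - J - 1 - n) else 0) * ∑ i, ρ n (sel n i) ^ 2 ≤
      2 * (Cst * (F.L : ℝ) ^ (K - J - 1) / (F.L : ℝ) ^ (4 * 0) * ((5 ^ (F.P K).d : ℕ) : ℝ) ^ 2 * (((2 * (θ + 2) + 1) ^ (F.P K).d * η : ℕ) : ℝ) *
            (2 * ((((F.P K).L ^ (F.P K).d : ℕ) : ℝ) - 1) / ((((F.P K).L ^ (F.P K).d : ℕ) : ℝ) - 3)) *
          ((((F.P K).L ^ (F.P K).d : ℕ) : ℝ) ^ 0 * ∑ z, ρ 0 z ^ 2)) +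
        2 * W * ∑ j ∈ Finset.Icc 1 (K - J), w j *
          (Cst * (F.L : ℝ) ^ (K - J - 1) / (F.L : ℝ) ^ (4 * j) * ((5 ^ (F.P K).d : ℕ) : ℝ) ^ 2 * (((2 * (θ + 2) + 1) ^ (F.P K).d * η : ℕ) : ℝ) *
              (2 * ((((F.P K).L ^ (F.P K).d : ℕ) : ℝ) - 1) / ((((F.P K).L ^ (F.P K).d : ℕ) : ℝ) - 3)) *
            ((((F.P K).L ^ (F.P K).d : ℕ) : ℝ) ^ j * ∑ c, src j c ^ 2)) := by
  have hm : K - J ≤ (F.P K).m + (F.P K).K := by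
    show K - J ≤ F.m + K
    omega
  have hΛ : ∀ n, 0 ≤ (if n < K - J then Cst * (F.L : ℝ) ^ (K - J - 1 - n) else 0) := by
    intro n
    split_ifs
    · exact mul_nonneg hCst (pow_nonneg (by exact_mod_cast (Nat.zero_le _)) _)
    · exact le_rfl
  exact weighted_readMax_sq_le_sources (four_le_L_cube F K) hμν hm ends θ η hends ρ src hρ hsrc hrow
    (fun n => if n < K - J then Cst * (F.L : ℝ) ^ (K - J - 1 - n) else 0) hΛ
    (fun j => Cst * (F.L : ℝ) ^ (K - J - 1) / (F.L : ℝ) ^ (4 * j))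
    (fun j _ n _ => flat_T3 F Cst hCst j n) w hw W hW sel hsel

end Summit.QuantumFields.YangMills.Theorems.FluctuationComparisonRegPrIntLS2BetaCurlBudgetT3

end
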